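import Mathlib
import Literature.NumberTheory.Transcendental.PeriodsWave0
import HarnessLib

/-!
# Dupont: Beukers–Ball–Rivoal cube integrals are linear forms in zeta values, with parity vanishing

Topic `Literature/NumberTheory/Irrationality/Dupont2018`. Typed, cited statement (no proof) of
C. Dupont, *Odd zeta motive and linear forms in odd zeta values*, Compositio Math. **154** (2018) 342–379
= arXiv:1601.00950 [Dupont2018OddZeta], **Corollary 5.6** (of Theorems 1.1/5.1 and 1.2/5.5): for integers
`n ≥ 1`, `N ≥ 0`, `u₁,…,uₙ, v₁,…,vₙ ≥ 1` with `v₁ + ⋯ + vₙ ≥ N + 1`, the integral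
`∫_{[0,1]ⁿ} x₁^{u₁−1}⋯xₙ^{uₙ−1}(1−x₁)^{v₁−1}⋯(1−xₙ)^{vₙ−1} / (1 − x₁⋯xₙ)^N dx`
"is absolutely convergent and evaluates to a linear combination `a₀ + a₂ζ(2) + a₃ζ(3) + ⋯ + aₙζ(n)` with `a_k`
a rational number for every `k`. If furthermore we have `2uᵢ + vᵢ = N + 1` for every `i`, then we get: if
`(n+1)(N+1)` is odd then `a_k = 0` for `k ≠ 0` even; if `(n+1)(N+1)` is even then `a_k = 0` for `k` odd."
The special case `N = (2r+1)m+2, uᵢ = rm+1, vᵢ = m+1` recovers the Ball–Rivoal integrals [§5.2].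

Why the cell wants it (pub-zeta5; HONEST FRAMING: systematic search; no irrationality claim unless
certified): this is the one PROVED-IN-PRINT family-wide vanishing theorem for the "parasitic" even zeta
values in a Beukers-type family with free integer exponents (LITERATURE.md E1) — the search over
`(u, v, N)` with `2uᵢ + vᵢ = N + 1`, `(n+1)(N+1)` odd, produces forms in `1, ζ(3), ζ(5), …` only, by a
theorem rather than by experiment. Nothing here concerns the size or arithmetic of the coefficients.

## Contents
* `cubeIntegrand`, `cubeIntegral n N u v` — the integral over the closed unit cube `[0,1]ⁿ`
  (`Fin n → ℝ`, product Lebesgue measure; Bochner integral, junk `0` when not integrable);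
* `corollary_5_6` — the NAMED FACT, with `ζ(k) = zetaValue k`; DISCHARGED in the sibling module
  `Dupont2018.CubeIntegralZeta` (`corollary_5_6_holds`, via the hypergeometric series of `Dupont2018.CubeIntegralSeries`
  and the partial-fraction machinery of `CressonFischlerRivoal2008.WellPoisedSymmetry`; the discharge cannot live in this
  file because those modules import it).

Not here: Theorems 1.1/5.1 for general integrable forms `P(x)/(1 − x₁⋯xₙ)^N dx` (the class of
"integrable algebraic forms" would need the pole-order bookkeeping of Prop. 3.? of the source), the cycles
`σ_k` and the coefficient formula `a_k = (2πi)^{−k}∫_{σ_k} ω`, the motive `𝒵^{odd}` (Thms 1.3–1.4), and the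
appendix with Zagier.
-/

noncomputable section

open MeasureTheory

namespace Literature.NumberTheory.Irrationality.Dupont2018

open Literature.NumberTheory.Transcendental (zetaValue)

/-- The integrand `x₁^{u₁−1}⋯xₙ^{uₙ−1}(1−x₁)^{v₁−1}⋯(1−xₙ)^{vₙ−1} / (1 − x₁⋯xₙ)^N` on `ℝⁿ`.
[cite: Dupont2018OddZeta, Corollary 5.6 (the integrand of §5.2)] -/
def cubeIntegrand (n N : ℕ) (u v : Fin n → ℕ) (x : Fin n → ℝ) : ℝ :=
  (∏ i, x i ^ (u i - 1) * (1 - x i) ^ (v i - 1)) / (1 - ∏ i, x i) ^ N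

/-- The closed unit cube `[0,1]ⁿ ⊂ ℝⁿ`. [cite: Dupont2018OddZeta, §1.1 eq. (1.2)] -/
def unitCube (n : ℕ) : Set (Fin n → ℝ) :=
  Set.pi Set.univ fun _ => Set.Icc (0 : ℝ) 1

/-- `∫_{[0,1]ⁿ} cubeIntegrand` (Bochner integral for the product Lebesgue measure; the value is the junk
`0` if the integrand is not integrable). [cite: Dupont2018OddZeta, Corollary 5.6] -/
def cubeIntegral (n N : ℕ) (u v : Fin n → ℕ) : ℝ :=
  ∫ x in unitCube n, cubeIntegrand n N u v x

/-- **Corollary 5.6** of [Dupont2018OddZeta] (named fact; PROVED as `corollary_5_6_holds` in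
`Dupont2018.CubeIntegralZeta`). Let `n ≥ 1`, `N ≥ 0`,
`uᵢ, vᵢ ≥ 1` be integers with `v₁ + ⋯ + vₙ ≥ N + 1`. Then the cube integral "is absolutely convergent and
evaluates to a linear combination `a₀ + a₂ζ(2) + a₃ζ(3) + ⋯ + aₙζ(n)` with `a_k` a rational number for
every `k`. If furthermore we have `2uᵢ + vᵢ = N + 1` for every `i`, then we get: if `(n+1)(N+1)` is odd
then `a_k = 0` for `k ≠ 0` even; if `(n+1)(N+1)` is even then `a_k = 0` for `k` odd."
(`ζ(k) = zetaValue k`; the coefficient vector is indexed by `k = 0, 2, 3, …, n`, with no `ζ(1)` term.)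
[cite: Dupont2018OddZeta, Corollary 5.6] -/
def corollary_5_6 : Prop :=
  ∀ (n N : ℕ) (u v : Fin n → ℕ), 1 ≤ n → (∀ i, 1 ≤ u i) → (∀ i, 1 ≤ v i) → N + 1 ≤ ∑ i, v i →
    IntegrableOn (cubeIntegrand n N u v) (unitCube n) ∧
    ∃ a : ℕ → ℚ,
      (cubeIntegral n N u v = a 0 + ∑ k ∈ Finset.Icc 2 n, (a k : ℝ) * zetaValue k) ∧
      ((∀ i, 2 * u i + v i = N + 1) →
        (Odd ((n + 1) * (N + 1)) → ∀ k ∈ Finset.Icc 2 n, Even k → a k = 0) ∧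
        (Even ((n + 1) * (N + 1)) → ∀ k ∈ Finset.Icc 2 n, Odd k → a k = 0))

end Literature.NumberTheory.Irrationality.Dupont2018
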